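import Summits.QuantumFields.YangMills.Theorems.BalabanUVNodesN07TraceSectorProjection
import Summits.QuantumFields.YangMills.Theorems.BalabanUVNodesN07QOfRecordTraceSectors
import Literature.MathematicalPhysics.QuantumFieldTheory.Balaban1983to89.B11Eq103H1ComplexReality
import HarnessLib

/-!
# NODE N07 — SECT. C's `Δ_{1,a}(U₀; Δ₁)`, `G₁`, `(QG₁Q†)⁻¹`, `H₁ = G₁Q†(QG₁Q†)⁻¹` OF RECORD COMMUTE WITH THE FIBREWISE SCALAR PART (respect the trace sectors) AT EVERY GUARDED
# BACKGROUND, for every Hessian slot `Δ₁` that does — the trace companion of ✓p821715 `…N07H1OfRecordReality`, by lit's generic ✓`B11Eq103H1ComplexReality.G1K_map_comm` ∕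
# `KinvK_map_comm` ∕ `H1K_map_comm` at `σ := scalPartW` ([15] (45) p. 285, (103) p. 293, (110) p. 294, (51) p. 286; [B9] (3.24)–(3.26) pp. 394–395)

Cell `pub-ymgap`, width seat `pub-ymgap-dag-n07-w3` (g26), CLAIM-20.  `--kind proof --supports stmt-QuantumFields-27238 --as helper`; count-neutral.
[15] = [Balaban1985Variational]; [B9] = [Balaban1985BackgroundPropagators].

CONTENTS (`S := scalPartW N _` on each carrier; guard `SmallBelow (avOfRecord F N K) k U₀`; `N ≥ 1`).
* §0 (generic Hilbert spaces) `adjoint_map_comm_of_isSymmetric` — if `T S_E = S_F T` with `S_E`, `S_F` symmetric then `T† S_F = S_E T†`.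
* §1 `scalPartW_comp_QOfRecord` (✓`…N07QOfRecordTraceSectors`), `scalPartW_adjoint_QOfRecord`, ★`scalPartW_laplaceAOfRecordAt` (any slot `Δ₁` commuting with `S`),
  `scalPartW_laplaceAOfRecordAt_hessOpOfRecord_two`, `scalPartW_H1LatticeK_ofRecord_two` (`N = 2`, bare slot `Δ(U₀)`).
* §2 ★★`scalPartW_G1LatticeK_ofRecord`, ★★`scalPartW_KinvLatticeK_ofRecord`, ★★`scalPartW_H1LatticeK_ofRecord` (any commuting slot `Δ₁`; displayed `hpos`, `hQ` as in the letters).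

HONEST LABELS.  Instantiation of lit's generic commuting lemmas; no estimate; `H♭`'s (115) reading, `𝔊`, `π`, `C^{𝔰𝔩}`, `W` trace letters still owed.  Count-neutral; N07 NOT discharged;
P0 ⟨26900⟩ OPEN; R4 is the conditional finite-𝕋⁴ rung only.  Nothing here is a claim about the Yang–Mills mass gap (`Summit.QuantumFields`): finite torus, fixed `ε`; nothing
continuum ∕ OS ∕ Clay.
-/

set_option autoImplicit false

noncomputable section

open scoped Matrix Matrix.Norms.L2Operator InnerProductSpace ComplexConjugate BigOperators

namespace Summit.QuantumFields.YangMills.Theorems.N07H1OfRecordTraceSectors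

open Literature.MathematicalPhysics.QuantumFieldTheory.Balaban1983to89
open Literature.MathematicalPhysics.QuantumFieldTheory.Balaban1983to89.T4Continuum (T4Family)
open T4Continuum BlockAveraging
open Node00
open B9SectCLatticeCarrier (Bond)
open B9Eq311L2Pairing (WL2)
open B11Eq103H1Complex (SiteL2K BondL2K covDerivL2K covDivL2K laplaceALatticeK laplaceAK G1K G1LatticeK KinvK KinvLatticeK H1K H1LatticeK)
open B11Eq103H1ComplexReality (laplaceAK_map_comm G1K_map_comm KinvK_map_comm H1K_map_comm)
open Summit.QuantumFields.YangMills.Theorems.N07TraceSectorDefs (scalPartW)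
open Summit.QuantumFields.YangMills.Theorems.N07TraceSectorProjection (scalPartW_isSymmetric comp_scalPartW_eq_iff scalPartW_comp_covDerivL2K_ofRecord
  scalPartW_comp_covDivL2K_ofRecord scalPartW_comp_RrOfRecord scalPartW_comp_hessOpOfRecord_two)
open Summit.QuantumFields.YangMills.Theorems.N07QOfRecordTraceSectors (QOfRecord_traceless QOfRecord_scalar)

/-! ## §0  Adjoints of intertwiners of symmetric operators -/

section Adjoint

variable {E F : Type*} [NormedAddCommGroup E] [InnerProductSpace ℂ E] [NormedAddCommGroup F] [InnerProductSpace ℂ F]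
  [FiniteDimensional ℂ E] [FiniteDimensional ℂ F]

/-- **If `T S_E = S_F T` for SYMMETRIC `S_E`, `S_F`, then `T† S_F = S_E T†`** (`⟪x, T†S_F y⟫ = ⟪S_F T x, y⟫ = ⟪T S_E x, y⟫ = ⟪x, S_E T† y⟫`). [folklore]
[cite: Balaban1985BackgroundPropagators, (3.24) p.394 (where it is used: `Q*`)] -/
theorem adjoint_map_comm_of_isSymmetric (T : E →ₗ[ℂ] F) {SE : E →ₗ[ℂ] E} {SF : F →ₗ[ℂ] F} (hSE : SE.IsSymmetric) (hSF : SF.IsSymmetric)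
    (h : ∀ x, T (SE x) = SF (T x)) (y : F) : LinearMap.adjoint T (SF y) = SE (LinearMap.adjoint T y) := by
  apply ext_inner_left ℂ
  intro x
  rw [LinearMap.adjoint_inner_right, ← hSF, ← h, ← LinearMap.adjoint_inner_right, hSE]

end Adjoint

/-! ## §1  `Q(U₀)`, `Q(U₀)†`, `Δ_{1,a}(U₀; Δ₁)` commute with the scalar part -/

section Record

variable (F : T4Family) (N : ℕ) [NeZero N] {K : ℕ} (k : ℕ) (U₀ : GaugeField (F.P K) 0 (SU N)) [Fact (0 < c0Rec F K k)] [Fact (∀ c, 0 < wBRec F K k c)]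

omit [Fact (0 < c0Rec F K k)] [Fact (∀ c, 0 < wBRec F K k c)] in
/-- **`S ∘ Q(U₀) = Q(U₀) ∘ S`** under the guard (✓`QOfRecord_traceless` ∕ `QOfRecord_scalar`). [cite: Balaban1985BackgroundPropagators, (3.13)–(3.16) p.393; Balaban1985Variational, (51) p.286] -/
theorem scalPartW_comp_QOfRecord (h : SmallBelow (avOfRecord F N K) k U₀) :
    scalPartW N (wBRec F K k) ∘ₗ QOfRecord F N k U₀ = QOfRecord F N k U₀ ∘ₗ scalPartW N _ :=
  (comp_scalPartW_eq_iff N _ _ _).2 ⟨fun _ hA => QOfRecord_traceless F N k U₀ h hA, fun _ hA => QOfRecord_scalar F N k U₀ h hA⟩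

/-- **`Q(U₀)† ∘ S = S ∘ Q(U₀)†`** under the guard (§0; `S` symmetric on both carriers). [cite: Balaban1985BackgroundPropagators, (3.24) p.394] -/
theorem scalPartW_adjoint_QOfRecord (h : SmallBelow (avOfRecord F N K) k U₀) (g : WL2 ℂ (wBRec F K k) (WRec N)) :
    LinearMap.adjoint (QOfRecord F N k U₀) (scalPartW N (wBRec F K k) g) = scalPartW N _ (LinearMap.adjoint (QOfRecord F N k U₀) g) :=
  adjoint_map_comm_of_isSymmetric _ (scalPartW_isSymmetric N _) (scalPartW_isSymmetric N _)
    (fun x => (LinearMap.congr_fun (scalPartW_comp_QOfRecord F N k U₀ h) x).symm) g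

set_option maxHeartbeats 1600000 in
/-- ★ **`Δ_{1,a}(U₀; Δ₁) = Δ₁ + DRD* + aQ†Q` COMMUTES WITH THE SCALAR PART FOR EVERY SLOT `Δ₁` THAT DOES** (letters `(Q(U₀), Q′♭)`, guard; lit ✓`laplaceAK_map_comm`).
[cite: Balaban1985Variational, (110) p.294; Balaban1985BackgroundPropagators, (3.26) p.395] -/
theorem scalPartW_laplaceAOfRecordAt (h : SmallBelow (avOfRecord F N K) k U₀)
    {Δ₁ : BondL2K ℂ (F.P K).d (fun _ => (F.P K).sitesPerDir 0) (c0Rec F K k) (WRec N) →ₗ[ℂ]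
      BondL2K ℂ (F.P K).d (fun _ => (F.P K).sitesPerDir 0) (c0Rec F K k) (WRec N)}
    (hΔ₁ : ∀ x, Δ₁ (scalPartW N _ x) = scalPartW N _ (Δ₁ x)) (a : ℝ)
    (x : BondL2K ℂ (F.P K).d (fun _ => (F.P K).sitesPerDir 0) (c0Rec F K k) (WRec N)) :
    laplaceAOfRecordAt F N k U₀ Δ₁ (QOfRecord F N k U₀) (QflatOfRecord F N k) a (scalPartW N _ x) =
      scalPartW N _ (laplaceAOfRecordAt F N k U₀ Δ₁ (QOfRecord F N k U₀) (QflatOfRecord F N k) a x) := by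
  unfold laplaceAOfRecordAt laplaceALatticeK
  exact laplaceAK_map_comm (fun x y => map_add _ x y) hΔ₁ (fun s => (LinearMap.congr_fun (scalPartW_comp_covDerivL2K_ofRecord F N K k U₀) s).symm)
    (fun s => (LinearMap.congr_fun (scalPartW_comp_RrOfRecord F N K k U₀) s).symm)
    (fun x => (LinearMap.congr_fun (scalPartW_comp_covDivL2K_ofRecord F N K k U₀) x).symm)
    (fun x => (LinearMap.congr_fun (scalPartW_comp_QOfRecord F N k U₀ h) x).symm) (scalPartW_adjoint_QOfRecord F N k U₀ h)
    (fun y => map_smul _ _ y) x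

/-! ## §2  `G₁`, `(QG₁Q†)⁻¹`, `H₁` commute with the scalar part -/

variable {Δ₁ : BondL2K ℂ (F.P K).d (fun _ => (F.P K).sitesPerDir 0) (c0Rec F K k) (WRec N) →ₗ[ℂ]
    BondL2K ℂ (F.P K).d (fun _ => (F.P K).sitesPerDir 0) (c0Rec F K k) (WRec N)} {a : ℝ}
  (hpos : ∀ x, x ≠ 0 → 0 < RCLike.re ⟪x, laplaceAOfRecordAt F N k U₀ Δ₁ (QOfRecord F N k U₀) (QflatOfRecord F N k) a x⟫_ℂ)

/-- ★★ **`G₁ = Δ_{1,a}(U₀; Δ₁)⁻¹` COMMUTES WITH THE SCALAR PART** (slot `Δ₁` commuting, guard; lit ✓`G1K_map_comm`). [cite: Balaban1985Variational, (110) p.294, (51) p.286; Balaban1985BackgroundPropagators, Thm 3.11 p.416] -/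
theorem scalPartW_G1LatticeK_ofRecord (h : SmallBelow (avOfRecord F N K) k U₀) (hΔ₁ : ∀ x, Δ₁ (scalPartW N _ x) = scalPartW N _ (Δ₁ x))
    (x : BondL2K ℂ (F.P K).d (fun _ => (F.P K).sitesPerDir 0) (c0Rec F K k) (WRec N)) :
    G1LatticeK hpos (scalPartW N _ x) = scalPartW N _ (G1LatticeK hpos x) := by
  unfold G1LatticeK
  exact G1K_map_comm hpos (fun x y => map_add _ x y) hΔ₁ (fun s => (LinearMap.congr_fun (scalPartW_comp_covDerivL2K_ofRecord F N K k U₀) s).symm)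
    (fun s => (LinearMap.congr_fun (scalPartW_comp_RrOfRecord F N K k U₀) s).symm)
    (fun x => (LinearMap.congr_fun (scalPartW_comp_covDivL2K_ofRecord F N K k U₀) x).symm)
    (fun x => (LinearMap.congr_fun (scalPartW_comp_QOfRecord F N k U₀ h) x).symm) (scalPartW_adjoint_QOfRecord F N k U₀ h)
    (fun y => map_smul _ _ y) x

/-- ★★ **`(QG₁Q†)⁻¹` COMMUTES WITH THE SCALAR PART** (lit ✓`KinvK_map_comm`). [cite: Balaban1985Variational, (45) p.285, (103) p.293, (51) p.286] -/
theorem scalPartW_KinvLatticeK_ofRecord (h : SmallBelow (avOfRecord F N K) k U₀) (hΔ₁ : ∀ x, Δ₁ (scalPartW N _ x) = scalPartW N _ (Δ₁ x))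
    (hQ : Function.Surjective (QOfRecord F N k U₀)) (g : WL2 ℂ (wBRec F K k) (WRec N)) :
    KinvLatticeK hpos hQ (scalPartW N _ g) = scalPartW N _ (KinvLatticeK hpos hQ g) := by
  unfold KinvLatticeK
  exact KinvK_map_comm hpos _ _ (fun x y => map_add _ x y) hΔ₁ (fun s => (LinearMap.congr_fun (scalPartW_comp_covDerivL2K_ofRecord F N K k U₀) s).symm)
    (fun s => (LinearMap.congr_fun (scalPartW_comp_RrOfRecord F N K k U₀) s).symm)
    (fun x => (LinearMap.congr_fun (scalPartW_comp_covDivL2K_ofRecord F N K k U₀) x).symm)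
    (fun x => (LinearMap.congr_fun (scalPartW_comp_QOfRecord F N k U₀ h) x).symm) (scalPartW_adjoint_QOfRecord F N k U₀ h)
    (fun y => map_smul _ _ y) g

/-- ★★ **`H₁ = G₁Q†(QG₁Q†)⁻¹` OF (45)∕(103) COMMUTES WITH THE SCALAR PART** — print's «for 𝔤-valued `B`, `H₁B` is 𝔤-valued», trace half, Hilbert level (lit ✓`H1K_map_comm`).
[cite: Balaban1985Variational, (45) p.285, (103) p.293, (51) p.286; Balaban1985BackgroundPropagators, (3.129) p.421] -/
theorem scalPartW_H1LatticeK_ofRecord (h : SmallBelow (avOfRecord F N K) k U₀) (hΔ₁ : ∀ x, Δ₁ (scalPartW N _ x) = scalPartW N _ (Δ₁ x))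
    (hQ : Function.Surjective (QOfRecord F N k U₀)) (g : WL2 ℂ (wBRec F K k) (WRec N)) :
    H1LatticeK hpos hQ (scalPartW N _ g) = scalPartW N _ (H1LatticeK hpos hQ g) := by
  unfold H1LatticeK
  exact H1K_map_comm hpos _ _ (fun x y => map_add _ x y) hΔ₁ (fun s => (LinearMap.congr_fun (scalPartW_comp_covDerivL2K_ofRecord F N K k U₀) s).symm)
    (fun s => (LinearMap.congr_fun (scalPartW_comp_RrOfRecord F N K k U₀) s).symm)
    (fun x => (LinearMap.congr_fun (scalPartW_comp_covDivL2K_ofRecord F N K k U₀) x).symm)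
    (fun x => (LinearMap.congr_fun (scalPartW_comp_QOfRecord F N k U₀ h) x).symm) (scalPartW_adjoint_QOfRecord F N k U₀ h)
    (fun y => map_smul _ _ y) g

end Record

/-! ## §3  `N = 2`: the bare slot `Δ₁ := Δ(U₀)` -/

section SU2

variable (F : T4Family) {K : ℕ} (k : ℕ) (U₀ : GaugeField (F.P K) 0 (SU 2)) [Fact (0 < c0Rec F K k)] [Fact (∀ c, 0 < wBRec F K k c)]

/-- **At `N = 2`, `Δ_{1,a}(U₀; Δ(U₀))` (the bare slot) commutes with the scalar part** (✓`scalPartW_comp_hessOpOfRecord_two`). [cite: Balaban1985Variational, (110) p.294; Balaban1985BackgroundPropagators, (3.26) p.395] -/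
theorem scalPartW_laplaceAOfRecordAt_hessOpOfRecord_two (h : SmallBelow (avOfRecord F 2 K) k U₀) (a : ℝ)
    (x : BondL2K ℂ (F.P K).d (fun _ => (F.P K).sitesPerDir 0) (c0Rec F K k) (WRec 2)) :
    laplaceAOfRecordAt F 2 k U₀ (hessOpOfRecord F 2 k U₀) (QOfRecord F 2 k U₀) (QflatOfRecord F 2 k) a (scalPartW 2 _ x) =
      scalPartW 2 _ (laplaceAOfRecordAt F 2 k U₀ (hessOpOfRecord F 2 k U₀) (QOfRecord F 2 k U₀) (QflatOfRecord F 2 k) a x) :=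
  scalPartW_laplaceAOfRecordAt F 2 k U₀ h (fun x => (LinearMap.congr_fun (scalPartW_comp_hessOpOfRecord_two F K k U₀) x).symm) a x

set_option maxRecDepth 8192 in
/-- ★★ **At `N = 2`, `H₁(U₀; Δ(U₀))` (the bare slot) commutes with the scalar part.** [cite: Balaban1985Variational, (45) p.285, (103) p.293, (51) p.286] -/
theorem scalPartW_H1LatticeK_ofRecord_two (h : SmallBelow (avOfRecord F 2 K) k U₀) {a : ℝ}
    (hpos : ∀ x, x ≠ 0 → 0 < RCLike.re ⟪x, laplaceAOfRecordAt F 2 k U₀ (hessOpOfRecord F 2 k U₀) (QOfRecord F 2 k U₀) (QflatOfRecord F 2 k) a x⟫_ℂ)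
    (hQ : Function.Surjective (QOfRecord F 2 k U₀)) (g : WL2 ℂ (wBRec F K k) (WRec 2)) :
    H1LatticeK hpos hQ (scalPartW 2 _ g) = scalPartW 2 _ (H1LatticeK hpos hQ g) :=
  scalPartW_H1LatticeK_ofRecord F 2 k U₀ (Δ₁ := hessOpOfRecord F 2 k U₀) hpos h
    (fun x => (LinearMap.congr_fun (scalPartW_comp_hessOpOfRecord_two F K k U₀) x).symm) hQ g

end SU2

end Summit.QuantumFields.YangMills.Theorems.N07H1OfRecordTraceSectors

end
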